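import Summits.Ventures.HodgeRepro2.T5SU11JacobiWeight

/-!
# The derivative of the Jacobi transform in the weight: `(d/dk) m̂_k(λ) = −∫_G log|a(g)| · m_k φ_λ dν`

In the Laplace form `m̂_k(λ) = ∫_G e^{−k s(g)} φ_λ(g) dν`, `s(g) = log|a(g)| ≥ 0` (`T5SU11JacobiWeight`),
the transform is differentiable in the weight with the derivative one expects — minus the first moment
of the phase:

  **`(d/dk) m̂_k(λ) = −∫_G log|a(g)| (1 − |g·0|²)^{k/2} φ_λ(g) dν`**

(`hasDerivAt_jacobi_weight`, by differentiation under the integral sign,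
`hasDerivAt_integral_of_dominated_loc_of_deriv_le`, with the dominating function
`(eε)⁻¹ m_{k−2ε} φ_λ` on the ball of radius `ε = (k − K₀)/4`, `K₀ = max(1, λ, 2 − λ)`, from the elementary
`s e^{−εs} ≤ (eε)⁻¹`: `mul_exp_neg_le`). Consequences: the phase-weighted integrand is integrable
(`integrable_log_norm_mat_mul_orbit_rpow_mul_sph`), the derivative is NEGATIVE (`deriv_jacobi_weight_neg`:
the integrand is positive on the open set `{g·0 ≠ 0}` — a second proof of the strict monotonicity
of `T5SU11JacobiWeight`), and **`(d/dk) log m̂_k(λ) = −⟨log|a|⟩_{k,λ}`**, minus the mean of the phase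
for the probability measure `m_k φ_λ dν / m̂_k(λ)` (`deriv_log_jacobi_weight`), a value in `[−log …, 0)`.
Nothing is claimed about (N).

Blind lane: Mathlib + the HodgeRepro2 prefix only; no sorry; axioms ⊆ {propext, Classical.choice,
Quot.sound}.
-/

namespace Summit.Ventures.HodgeRepro2.T5SU11JacobiWeightDeriv

open MeasureTheory MeasureTheory.Measure Metric Set Filter Topology
open T5SU11Unimodular T5SU11Fibration T5SU11Cartan T5HaarCircle T5BergmanCoefficient
  T5SU11FibrationHaar T5SU11SphericalFunction T5SU11SphericalSymmetry T5SU11SphericalBounds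
  T5SU11SphericalContinuous T5SU11JacobiIwasawa T5SU11JacobiTransform T5SU11KFiniteMajorantPow
  T5SU11JacobiWeight
open scoped Real

/-! ### Pointwise: the derivative of the integrand and the elementary bound -/

/-- `a ↦ a(g)` is continuous on `SU(1,1)`. -/
lemma continuous_mat_zero_zero : Continuous fun g : SU11 => mat g 0 0 :=
  (continuous_apply 0).comp ((continuous_apply 0).comp
    (continuous_subtype_val.comp continuous_subtype_val))

/-- The phase `g ↦ log|a(g)|` is continuous (`|a(g)| ≥ 1 > 0`). -/
lemma continuous_log_norm_mat : Continuous fun g : SU11 => Real.log ‖mat g 0 0‖ :=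
  continuous_mat_zero_zero.norm.log fun g => (norm_mat_pos g).ne'

/-- `log(1 − |g·0|²) = −2 log|a(g)|`. -/
lemma log_one_sub_norm_orbit_sq (g : SU11) :
    Real.log (1 - ‖orbit g‖ ^ 2) = -2 * Real.log ‖mat g 0 0‖ := by
  rw [one_sub_norm_orbit_sq, Real.log_pow, Real.log_inv]
  push_cast
  ring

/-- **`s e^{−εs} ≤ (eε)⁻¹`** for every real `s` and `ε > 0` (from `x + 1 ≤ e^x` at `x = εs − 1`). -/
theorem mul_exp_neg_le {s ε : ℝ} (hε : 0 < ε) :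
    s * Real.exp (-(ε * s)) ≤ (Real.exp 1 * ε)⁻¹ := by
  have h := Real.add_one_le_exp (ε * s - 1)
  rw [sub_add_cancel] at h
  -- `ε s ≤ e^{εs − 1} = e^{εs}/e`
  have he : 0 < Real.exp 1 := Real.exp_pos 1
  have hes : 0 < Real.exp (ε * s) := Real.exp_pos _
  rw [Real.exp_sub] at h
  rw [Real.exp_neg, ← div_eq_mul_inv, div_le_iff₀ hes, ← div_eq_inv_mul,
    le_div_iff₀ (mul_pos he hε)]
  have h' : ε * s * Real.exp 1 ≤ Real.exp (ε * s) := by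
    rwa [le_div_iff₀ he] at h
  linarith [h']

section measure

variable [MeasurableSpace Circle] [BorelSpace Circle]

omit [BorelSpace Circle] in
/-- **The derivative of the integrand in the weight**:
`(d/dk) (1 − |g·0|²)^{k/2} φ_λ(g) = −log|a(g)| · (1 − |g·0|²)^{k/2} φ_λ(g)`. -/
theorem hasDerivAt_orbit_rpow_mul_sph (lam : ℝ) (g : SU11) (k : ℝ) :
    HasDerivAt (fun k : ℝ => (1 - ‖orbit g‖ ^ 2) ^ (k / 2) * sph lam g)
      (-(Real.log ‖mat g 0 0‖) * ((1 - ‖orbit g‖ ^ 2) ^ (k / 2) * sph lam g)) k := by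
  have hx : 0 < 1 - ‖orbit g‖ ^ 2 := one_sub_norm_orbit_sq_pos g
  have h1 : HasDerivAt (fun x : ℝ => (1 - ‖orbit g‖ ^ 2) ^ x)
      ((1 - ‖orbit g‖ ^ 2) ^ (k / 2) * Real.log (1 - ‖orbit g‖ ^ 2)) (k / 2) :=
    (Real.hasStrictDerivAt_const_rpow hx (k / 2)).hasDerivAt
  have h2 : HasDerivAt (fun k : ℝ => k / 2) (1 / 2) k := by
    simpa using (hasDerivAt_id k).div_const 2
  have h3 := (h1.comp k h2).mul_const (sph lam g)
  refine h3.congr_deriv ?_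
  rw [log_one_sub_norm_orbit_sq]
  ring

/-! ### Differentiation under the integral sign -/

/-- **The derivative of the Jacobi transform in the weight**: for `(k, λ)` in the domain,
`(d/dk) m̂_k(λ) = −∫_G log|a(g)| (1 − |g·0|²)^{k/2} φ_λ(g) dν`, and the integrand on the right is
integrable. -/
theorem integrable_and_hasDerivAt_jacobi_weight {k lam : ℝ} (hk : 1 < k) (h1 : lam < k)
    (h2 : 2 < k + lam) :
    Integrable (fun g => -(Real.log ‖mat g 0 0‖) * ((1 - ‖orbit g‖ ^ 2) ^ (k / 2) * sph lam g))
        (nu haarCircle) ∧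
      HasDerivAt (fun k => ∫ g, (1 - ‖orbit g‖ ^ 2) ^ (k / 2) * sph lam g ∂(nu haarCircle))
        (∫ g, -(Real.log ‖mat g 0 0‖) * ((1 - ‖orbit g‖ ^ 2) ^ (k / 2) * sph lam g) ∂(nu haarCircle))
        k := by
  set K₀ : ℝ := max 1 (max lam (2 - lam)) with hK₀
  have hK : K₀ < k := by
    rw [hK₀, max_lt_iff, max_lt_iff]
    exact ⟨hk, h1, by linarith⟩
  have hK1 : 1 ≤ K₀ := le_max_left _ _
  have hK2 : lam ≤ K₀ := (le_max_left _ _).trans (le_max_right _ _)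
  have hK3 : 2 - lam ≤ K₀ := (le_max_right _ _).trans (le_max_right _ _)
  set ε : ℝ := (k - K₀) / 4 with hε
  have hε0 : 0 < ε := by
    rw [hε]
    linarith
  -- the dominating weight `k − 2ε = (k + K₀)/2` is in the domain
  have hk' : 1 < k - 2 * ε := by rw [hε]; linarith
  have h1' : lam < k - 2 * ε := by rw [hε]; linarith
  have h2' : 2 < k - 2 * ε + lam := by rw [hε]; linarith
  have hbound := (integrable_orbit_rpow_mul_sph hk' h1' h2').const_mul (Real.exp 1 * ε)⁻¹
  refine hasDerivAt_integral_of_dominated_loc_of_deriv_le (ball_mem_nhds k hε0)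
    (Filter.Eventually.of_forall fun x => ?_) (integrable_orbit_rpow_mul_sph hk h1 h2)
    (F' := fun k g => -(Real.log ‖mat g 0 0‖) * ((1 - ‖orbit g‖ ^ 2) ^ (k / 2) * sph lam g)) ?_
    (Filter.Eventually.of_forall fun g x hx => ?_) hbound
    (Filter.Eventually.of_forall fun g x _ => hasDerivAt_orbit_rpow_mul_sph lam g x)
  · exact ((continuous_orbit_rpow x).mul (continuous_sph lam)).aestronglyMeasurable
  · exact (continuous_log_norm_mat.neg.mul
      ((continuous_orbit_rpow k).mul (continuous_sph lam))).aestronglyMeasurable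
  · -- the bound: `|F'(x, g)| = s m_x φ ≤ s m_{k−ε} φ = (s e^{−εs}) m_{k−2ε} φ ≤ (eε)⁻¹ m_{k−2ε} φ`
    have hs0 : 0 ≤ Real.log ‖mat g 0 0‖ := log_norm_mat_nonneg g
    have hφ : 0 < sph lam g := sph_pos lam g
    have hxk : k - ε ≤ x := by
      rw [mem_ball, Real.dist_eq, abs_lt] at hx
      linarith [hx.1]
    show ‖-(Real.log ‖mat g 0 0‖) * ((1 - ‖orbit g‖ ^ 2) ^ (x / 2) * sph lam g)‖
      ≤ (Real.exp 1 * ε)⁻¹ * ((1 - ‖orbit g‖ ^ 2) ^ ((k - 2 * ε) / 2) * sph lam g)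
    rw [norm_mul, norm_neg, Real.norm_of_nonneg hs0,
      Real.norm_of_nonneg (mul_nonneg (orbit_rpow_nonneg x g) hφ.le)]
    have hm : (1 - ‖orbit g‖ ^ 2) ^ (x / 2) ≤ (1 - ‖orbit g‖ ^ 2) ^ ((k - ε) / 2) :=
      orbit_rpow_antitone hxk g
    have hsplit : (1 - ‖orbit g‖ ^ 2) ^ ((k - ε) / 2)
        = Real.exp (-(ε * Real.log ‖mat g 0 0‖)) * (1 - ‖orbit g‖ ^ 2) ^ ((k - 2 * ε) / 2) := by
      rw [orbit_rpow_eq_exp, orbit_rpow_eq_exp, ← Real.exp_add]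
      congr 1
      ring
    calc Real.log ‖mat g 0 0‖ * ((1 - ‖orbit g‖ ^ 2) ^ (x / 2) * sph lam g)
        ≤ Real.log ‖mat g 0 0‖ * ((1 - ‖orbit g‖ ^ 2) ^ ((k - ε) / 2) * sph lam g) := by gcongr
      _ = (Real.log ‖mat g 0 0‖ * Real.exp (-(ε * Real.log ‖mat g 0 0‖)))
            * ((1 - ‖orbit g‖ ^ 2) ^ ((k - 2 * ε) / 2) * sph lam g) := by
          rw [hsplit]
          ring
      _ ≤ (Real.exp 1 * ε)⁻¹ * ((1 - ‖orbit g‖ ^ 2) ^ ((k - 2 * ε) / 2) * sph lam g) :=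
          mul_le_mul_of_nonneg_right (mul_exp_neg_le hε0)
            (mul_nonneg (orbit_rpow_nonneg _ g) hφ.le)

/-- The phase-weighted integrand `log|a(g)| · m_k(g) φ_λ(g)` is `ν`-integrable on the domain. -/
theorem integrable_log_norm_mat_mul_orbit_rpow_mul_sph {k lam : ℝ} (hk : 1 < k) (h1 : lam < k)
    (h2 : 2 < k + lam) :
    Integrable (fun g => Real.log ‖mat g 0 0‖ * ((1 - ‖orbit g‖ ^ 2) ^ (k / 2) * sph lam g))
      (nu haarCircle) := by
  have h := (integrable_and_hasDerivAt_jacobi_weight hk h1 h2).1.neg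
  refine h.congr (Filter.Eventually.of_forall fun g => ?_)
  simp only [Pi.neg_apply, neg_mul, neg_neg]

/-- **`(d/dk) m̂_k(λ) = −∫_G log|a(g)| m_k(g) φ_λ(g) dν`** (`HasDerivAt` form). -/
theorem hasDerivAt_jacobi_weight {k lam : ℝ} (hk : 1 < k) (h1 : lam < k) (h2 : 2 < k + lam) :
    HasDerivAt (fun k => ∫ g, (1 - ‖orbit g‖ ^ 2) ^ (k / 2) * sph lam g ∂(nu haarCircle))
      (-∫ g, Real.log ‖mat g 0 0‖ * ((1 - ‖orbit g‖ ^ 2) ^ (k / 2) * sph lam g) ∂(nu haarCircle)) k := by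
  have h := (integrable_and_hasDerivAt_jacobi_weight hk h1 h2).2
  refine h.congr_deriv ?_
  rw [← integral_neg]
  refine integral_congr_ae (Filter.Eventually.of_forall fun g => ?_)
  simp only [neg_mul]

/-- **`(d/dk) m̂_k(λ) = −∫_G log|a(g)| m_k φ_λ dν`** (`deriv` form). -/
theorem deriv_jacobi_weight {k lam : ℝ} (hk : 1 < k) (h1 : lam < k) (h2 : 2 < k + lam) :
    deriv (fun k => ∫ g, (1 - ‖orbit g‖ ^ 2) ^ (k / 2) * sph lam g ∂(nu haarCircle)) k
      = -∫ g, Real.log ‖mat g 0 0‖ * ((1 - ‖orbit g‖ ^ 2) ^ (k / 2) * sph lam g) ∂(nu haarCircle) :=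
  (hasDerivAt_jacobi_weight hk h1 h2).deriv

/-! ### The sign of the derivative and the log-derivative -/

/-- The first moment of the phase is positive: `∫_G log|a(g)| m_k φ_λ dν > 0` (the integrand is
positive on the open set `{g·0 ≠ 0}`, where `|a(g)| > 1`). -/
theorem integral_log_norm_mat_mul_pos {k lam : ℝ} (hk : 1 < k) (h1 : lam < k) (h2 : 2 < k + lam) :
    0 < ∫ g, Real.log ‖mat g 0 0‖ * ((1 - ‖orbit g‖ ^ 2) ^ (k / 2) * sph lam g) ∂(nu haarCircle) := by
  have hnn : 0 ≤ fun g => Real.log ‖mat g 0 0‖ * ((1 - ‖orbit g‖ ^ 2) ^ (k / 2) * sph lam g) :=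
    fun g => mul_nonneg (log_norm_mat_nonneg g) (mul_nonneg (orbit_rpow_nonneg k g) (sph_pos lam g).le)
  rw [integral_pos_iff_support_of_nonneg hnn (integrable_log_norm_mat_mul_orbit_rpow_mul_sph hk h1 h2)]
  refine lt_of_lt_of_le nu_orbit_ne_zero_pos (measure_mono fun g hg => ?_)
  simp only [mem_setOf_eq] at hg
  simp only [Function.mem_support, ne_eq]
  -- `|a(g)| > 1` exactly when `g·0 ≠ 0`
  have hlt : 1 - ‖orbit g‖ ^ 2 < 1 := by
    have := norm_pos_iff.mpr hg
    nlinarith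
  have ha1 : 1 < ‖mat g 0 0‖ := by
    have hpos := norm_mat_pos g
    rw [one_sub_norm_orbit_sq] at hlt
    by_contra hle
    have hle' : ‖mat g 0 0‖ ≤ 1 := not_lt.mp hle
    have : 1 ≤ ‖mat g 0 0‖⁻¹ := one_le_inv₀ hpos |>.mpr hle'
    nlinarith
  have hs : 0 < Real.log ‖mat g 0 0‖ := Real.log_pos ha1
  exact (mul_pos hs (mul_pos (Real.rpow_pos_of_pos (one_sub_norm_orbit_sq_pos g) _) (sph_pos lam g))).ne'

/-- **The derivative is negative**: `(d/dk) m̂_k(λ) < 0` on the domain. -/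
theorem deriv_jacobi_weight_neg {k lam : ℝ} (hk : 1 < k) (h1 : lam < k) (h2 : 2 < k + lam) :
    deriv (fun k => ∫ g, (1 - ‖orbit g‖ ^ 2) ^ (k / 2) * sph lam g ∂(nu haarCircle)) k < 0 := by
  rw [deriv_jacobi_weight hk h1 h2, neg_lt_zero]
  exact integral_log_norm_mat_mul_pos hk h1 h2

/-- **The log-derivative is minus the mean phase**:
`(d/dk) log m̂_k(λ) = −(∫_G log|a(g)| m_k φ_λ dν)/m̂_k(λ)`. -/
theorem hasDerivAt_log_jacobi_weight {k lam : ℝ} (hk : 1 < k) (h1 : lam < k) (h2 : 2 < k + lam) :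
    HasDerivAt (fun k => Real.log (∫ g, (1 - ‖orbit g‖ ^ 2) ^ (k / 2) * sph lam g ∂(nu haarCircle)))
      (-(∫ g, Real.log ‖mat g 0 0‖ * ((1 - ‖orbit g‖ ^ 2) ^ (k / 2) * sph lam g) ∂(nu haarCircle))
        / ∫ g, (1 - ‖orbit g‖ ^ 2) ^ (k / 2) * sph lam g ∂(nu haarCircle)) k :=
  (hasDerivAt_jacobi_weight hk h1 h2).log (jacobi_pos hk h1 h2).ne'

/-- `(d/dk) log m̂_k(λ) = −⟨log|a|⟩_{k,λ}` (`deriv` form). -/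
theorem deriv_log_jacobi_weight {k lam : ℝ} (hk : 1 < k) (h1 : lam < k) (h2 : 2 < k + lam) :
    deriv (fun k => Real.log (∫ g, (1 - ‖orbit g‖ ^ 2) ^ (k / 2) * sph lam g ∂(nu haarCircle))) k
      = -(∫ g, Real.log ‖mat g 0 0‖ * ((1 - ‖orbit g‖ ^ 2) ^ (k / 2) * sph lam g) ∂(nu haarCircle))
        / ∫ g, (1 - ‖orbit g‖ ^ 2) ^ (k / 2) * sph lam g ∂(nu haarCircle) :=
  (hasDerivAt_log_jacobi_weight hk h1 h2).deriv

/-- The mean phase is positive: `(d/dk) log m̂_k(λ) < 0`. -/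
theorem deriv_log_jacobi_weight_neg {k lam : ℝ} (hk : 1 < k) (h1 : lam < k) (h2 : 2 < k + lam) :
    deriv (fun k => Real.log (∫ g, (1 - ‖orbit g‖ ^ 2) ^ (k / 2) * sph lam g ∂(nu haarCircle))) k
      < 0 := by
  rw [deriv_log_jacobi_weight hk h1 h2]
  exact div_neg_of_neg_of_pos (neg_lt_zero.mpr (integral_log_norm_mat_mul_pos hk h1 h2))
    (jacobi_pos hk h1 h2)

end measure

end Summit.Ventures.HodgeRepro2.T5SU11JacobiWeightDeriv
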